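import Summits.Ventures.HodgeRepro2.T6A2SegreCharts
import Mathlib.AlgebraicGeometry.Gluing
import Mathlib.AlgebraicGeometry.Morphisms.ClosedImmersion

/-!
# T6A2SegreGlue — the Segre embedding `ℙ(σ) ×_k ℙ(τ) ⟶ ℙ(σ × τ)`

Cell pub-hodge-repro2, Tier 6 (README §10), seat t6-p2 (A2 owner; gen 14, custodial). Towards a kernel
discharge of the A2 display `Hyp.Hartshorne1977_productProjective`. The Segre morphism `segre` is glued
(`Scheme.Cover.glueMorphisms`) from its chart pieces `segreChartMap : D₊(Xᵢ) × D₊(Yⱼ) ⟶ D₊(Z_{ij}) ⊂ ℙ(υ)`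
(`Spec` of the surjective `segreAway` followed by `awayι`), the compatibility on overlaps being
T6A2SegreTransition's `segreAway_compat` transported along the overlap identification of T6A2SegreCharts.
Then: the preimage of `D₊(Z_{ij})` is the product chart `(i, j)` (`segre_preimage_basicOpen`), so each
chart square is a pullback square (`isPullback_segre`), so `segre` is a closed immersion — closed
immersions are Zariski-local on the target and `Spec` of a surjection is one (`isClosedImmersion_segre`);
and `segre` is a morphism over `Spec k` (`segre_structMap`). Mathlib only; no display; no `sorry`;
standard axioms. §8(d): uses an L-value-free non-vanishing device: NO.
Filed in Tier-6 WAVE 1 (2026-08-26) as p440604 (definition lane, ACCEPTED 11:17Z, commit 06250c5bb12f); this v2 differs from the filed bytes in this module docstring only (the staged-record wording dropped).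
-/

namespace Summit.Ventures.HodgeRepro2.T6.A2Segre

open MvPolynomial HomogeneousLocalization TensorProduct CategoryTheory CategoryTheory.Limits
  AlgebraicGeometry Summit.Ventures.HodgeRepro2.T6.A2Surface

attribute [local instance] MvPolynomial.gradedAlgebra

universe u

variable (k : Type u) [Field k] {σ τ υ : Type u}

variable (υ) in
/-- the affine open cover of `ℙ(υ)` by the charts `D₊(Z_c)` -/
noncomputable def chartCover : (Proj (homogeneousSubmodule υ k)).AffineOpenCover :=
  Proj.affineOpenCoverOfIrrelevantLESpan (homogeneousSubmodule υ k) X (m := fun _ => 1)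
    (fun c => X_mem_homogeneousSubmodule_one k c) (fun _ => Nat.one_pos)
    (irrelevant_le_span_range_X k)

/-- the members of the chart cover of `ℙ(υ)` are the charts `awayι` -/
theorem chartCover_f (c : υ) :
    (chartCover k υ).openCover.f c =
      Proj.awayι (homogeneousSubmodule υ k) (X c) (X_mem_homogeneousSubmodule_one k c)
        Nat.one_pos := rfl

section overlapPoints

variable (i a : σ) (j b : τ)

/-- the overlap inclusion lands in the basic open `D(t)` -/
theorem overlapToChart_mem (y : Spec (CommRingCat.of (OverlapRing k i a j b))) :
    overlapToChart k i a j b y ∈ PrimeSpectrum.basicOpen (overlapElem k i a j b) := by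
  have h : overlapToChart k i a j b y ∈ Set.range (overlapToChart k i a j b) := ⟨y, rfl⟩
  rw [range_overlapToChart] at h
  exact h

/-- every point of the basic open `D(t)` comes from the overlap -/
theorem exists_overlapToChart_eq
    (w : Spec (CommRingCat.of (Away (homogeneousSubmodule σ k) (X i) ⊗[k]
      Away (homogeneousSubmodule τ k) (X j))))
    (hw : w ∈ PrimeSpectrum.basicOpen (overlapElem k i a j b)) :
    ∃ y, overlapToChart k i a j b y = w := by
  have h : w ∈ Set.range (overlapToChart k i a j b) := by
    rw [range_overlapToChart]
    exact hw
  exact h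

end overlapPoints

variable [DecidableEq υ] (e : σ × τ ≃ υ)

/-- the Segre map on the product chart `(i, j)`, into the chart `D₊(Z_{ij})` of `ℙ(υ)` -/
noncomputable def segreChartMap (i : σ) (j : τ) :
    Spec (CommRingCat.of (Away (homogeneousSubmodule σ k) (X i) ⊗[k]
      Away (homogeneousSubmodule τ k) (X j))) ⟶ Proj (homogeneousSubmodule υ k) :=
  Spec.map (CommRingCat.ofHom (segreAway k e i j).toRingHom) ≫
    Proj.awayι _ (X (e (i, j))) (X_mem_homogeneousSubmodule_one k (e (i, j))) Nat.one_pos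

/-- the chart pieces of the Segre map agree on the overlaps of the product charts -/
theorem segreChartMap_compat (ij ab : σ × τ) :
    pullback.fst ((prodChartCover k σ τ).f ij) ((prodChartCover k σ τ).f ab) ≫
        segreChartMap k e ij.1 ij.2 =
      pullback.snd ((prodChartCover k σ τ).f ij) ((prodChartCover k σ τ).f ab) ≫
        segreChartMap k e ab.1 ab.2 := by
  obtain ⟨i, j⟩ := ij
  obtain ⟨a, b⟩ := ab
  show pullback.fst (prodChart k (X_mem_homogeneousSubmodule_one k i) Nat.one_pos
          (X_mem_homogeneousSubmodule_one k j) Nat.one_pos)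
        (prodChart k (X_mem_homogeneousSubmodule_one k a) Nat.one_pos
          (X_mem_homogeneousSubmodule_one k b) Nat.one_pos) ≫ segreChartMap k e i j =
      pullback.snd (prodChart k (X_mem_homogeneousSubmodule_one k i) Nat.one_pos
          (X_mem_homogeneousSubmodule_one k j) Nat.one_pos)
        (prodChart k (X_mem_homogeneousSubmodule_one k a) Nat.one_pos
          (X_mem_homogeneousSubmodule_one k b) Nat.one_pos) ≫ segreChartMap k e a b
  -- the overlap `D(t)` and its inclusion into the pullback of the two charts
  have hv := SpecMap_transChart_prodChart k i a j b
  let e' : Spec (CommRingCat.of (OverlapRing k i a j b)) ⟶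
      pullback (prodChart k (X_mem_homogeneousSubmodule_one k i) Nat.one_pos
          (X_mem_homogeneousSubmodule_one k j) Nat.one_pos)
        (prodChart k (X_mem_homogeneousSubmodule_one k a) Nat.one_pos
          (X_mem_homogeneousSubmodule_one k b) Nat.one_pos) :=
    pullback.lift (overlapToChart k i a j b)
      (Spec.map (CommRingCat.ofHom (transChart k i a j b).toRingHom)) hv.symm
  -- `e'` is an isomorphism: both sides are open immersions with the same range
  have hrange : Set.range (overlapToChart k i a j b ≫
      prodChart k (X_mem_homogeneousSubmodule_one k i) Nat.one_pos
        (X_mem_homogeneousSubmodule_one k j) Nat.one_pos) =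
      Set.range (pullback.fst (prodChart k (X_mem_homogeneousSubmodule_one k i) Nat.one_pos
          (X_mem_homogeneousSubmodule_one k j) Nat.one_pos)
        (prodChart k (X_mem_homogeneousSubmodule_one k a) Nat.one_pos
          (X_mem_homogeneousSubmodule_one k b) Nat.one_pos) ≫
        prodChart k (X_mem_homogeneousSubmodule_one k i) Nat.one_pos
          (X_mem_homogeneousSubmodule_one k j) Nat.one_pos) := by
    rw [IsOpenImmersion.range_pullback_to_base_of_left]
    ext x
    constructor
    · rintro ⟨w, rfl⟩
      rw [Scheme.Hom.comp_apply]
      refine ⟨⟨_, rfl⟩, ?_⟩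
      rw [prodChart_apply_mem_range_iff]
      exact overlapToChart_mem k i a j b w
    · rintro ⟨⟨w, rfl⟩, hw⟩
      rw [prodChart_apply_mem_range_iff] at hw
      obtain ⟨y, rfl⟩ := exists_overlapToChart_eq k i a j b w hw
      exact ⟨y, (Scheme.Hom.comp_apply _ _ _).symm⟩
  have he : e' = (IsOpenImmersion.isoOfRangeEq _ _ hrange).hom := by
    apply IsOpenImmersion.lift_uniq
    show pullback.lift _ _ _ ≫ (pullback.fst _ _ ≫ _) = _
    rw [← Category.assoc, pullback.lift_fst]
  haveI : IsIso e' := by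
    rw [he]
    infer_instance
  rw [← cancel_epi e', ← Category.assoc, ← Category.assoc, pullback.lift_fst, pullback.lift_snd,
    segreChartMap, segreChartMap, overlapToChart, ← Category.assoc, ← Category.assoc,
    ← Spec.map_comp, ← Spec.map_comp, ← CommRingCat.ofHom_comp, ← CommRingCat.ofHom_comp,
    segreAway_compat]
  have hG : (algebraMap _ (OverlapRing k i a j b)).comp (segreAway k e i j).toRingHom =
      (segreToOverlap k e i a j b).toRingHom := rfl
  rw [hG, SpecMap_transAway_awayι k (segreToOverlap k e i a j b).toRingHom
      (isUnit_segreToOverlap k e i a j b),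
    SpecMap_liftAway_awayι k (segreToOverlap k e i a j b).toRingHom
      (isUnit_segreToOverlap k e i a j b)]

/-- **THE SEGRE MORPHISM** `ℙ(σ) ×_k ℙ(τ) ⟶ ℙ(υ)`, glued from its chart pieces -/
noncomputable def segre : prodProj k σ τ ⟶ Proj (homogeneousSubmodule υ k) :=
  (prodChartCover k σ τ).glueMorphisms (fun ij => segreChartMap k e ij.1 ij.2)
    (segreChartMap_compat k e)

/-- the Segre morphism restricted to the product chart `(i, j)` is its chart piece -/
theorem prodChart_segre (i : σ) (j : τ) :
    prodChart k (X_mem_homogeneousSubmodule_one k i) Nat.one_pos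
        (X_mem_homogeneousSubmodule_one k j) Nat.one_pos ≫ segre k e =
      segreChartMap k e i j :=
  (prodChartCover k σ τ).ι_glueMorphisms _ _ (i, j)

/-- the preimage of the chart `D₊(Z_{ij})` under the Segre morphism is the product chart `(i, j)` -/
theorem segre_preimage_basicOpen (i : σ) (j : τ) :
    segre k e ⁻¹ᵁ Proj.basicOpen (homogeneousSubmodule υ k) (X (e (i, j))) =
      (prodChart k (X_mem_homogeneousSubmodule_one k i) Nat.one_pos
        (X_mem_homogeneousSubmodule_one k j) Nat.one_pos).opensRange := by
  ext x
  obtain ⟨a, b, w, rfl⟩ := exists_prodChart_eq k x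
  have h1 : Proj.awayι _ (X (e (a, b))) (X_mem_homogeneousSubmodule_one k (e (a, b))) Nat.one_pos
      (Spec.map (CommRingCat.ofHom (segreAway k e a b).toRingHom) w) ∈
        Proj.basicOpen (homogeneousSubmodule υ k) (X (e (i, j))) ↔
      w ∈ PrimeSpectrum.basicOpen (overlapElem k a i b j) := by
    have h := Proj.awayι_preimage_basicOpen (homogeneousSubmodule υ k)
      (X_mem_homogeneousSubmodule_one k (e (a, b))) Nat.one_pos
      (X_mem_homogeneousSubmodule_one k (e (i, j))) Nat.one_pos
    rw [isLocalizationElem_eq] at h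
    change Spec.map (CommRingCat.ofHom (segreAway k e a b).toRingHom) w ∈
      Proj.awayι _ (X (e (a, b))) (X_mem_homogeneousSubmodule_one k (e (a, b))) Nat.one_pos ⁻¹ᵁ
        Proj.basicOpen (homogeneousSubmodule υ k) (X (e (i, j))) ↔ _
    rw [h]
    change w ∈ PrimeSpectrum.basicOpen
      (segreAway k e a b (chartCoord k (e (a, b)) (e (i, j)))) ↔ _
    rw [segreAway_chartCoord_overlap]
  change segre k e (prodChart k (X_mem_homogeneousSubmodule_one k a) Nat.one_pos
      (X_mem_homogeneousSubmodule_one k b) Nat.one_pos w) ∈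
      Proj.basicOpen (homogeneousSubmodule υ k) (X (e (i, j))) ↔
    prodChart k (X_mem_homogeneousSubmodule_one k a) Nat.one_pos
      (X_mem_homogeneousSubmodule_one k b) Nat.one_pos w ∈
      Set.range (prodChart k (X_mem_homogeneousSubmodule_one k i) Nat.one_pos
        (X_mem_homogeneousSubmodule_one k j) Nat.one_pos)
  rw [← Scheme.Hom.comp_apply, prodChart_segre, segreChartMap, Scheme.Hom.comp_apply, h1,
    prodChart_apply_mem_range_iff]

/-- the chart square of the Segre morphism is a pullback square -/
theorem isPullback_segre (i : σ) (j : τ) :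
    IsPullback (Spec.map (CommRingCat.ofHom (segreAway k e i j).toRingHom))
      (prodChart k (X_mem_homogeneousSubmodule_one k i) Nat.one_pos
        (X_mem_homogeneousSubmodule_one k j) Nat.one_pos)
      (Proj.awayι _ (X (e (i, j))) (X_mem_homogeneousSubmodule_one k (e (i, j))) Nat.one_pos)
      (segre k e) :=
  IsOpenImmersion.isPullback _ _ _ _ (prodChart_segre k e i j)
    (by rw [Proj.opensRange_awayι, segre_preimage_basicOpen])

/-- **THE SEGRE MORPHISM IS A CLOSED IMMERSION** -/
theorem isClosedImmersion_segre : IsClosedImmersion (segre k e) := by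
  apply IsZariskiLocalAtTarget.of_openCover (chartCover k υ).openCover
  intro c
  obtain ⟨⟨i, j⟩, rfl⟩ := e.surjective c
  have h := (isPullback_segre k e i j).flip
  have hsnd : pullback.snd (segre k e) (Proj.awayι _ (X (e (i, j)))
      (X_mem_homogeneousSubmodule_one k (e (i, j))) Nat.one_pos) =
      h.isoPullback.inv ≫ Spec.map (CommRingCat.ofHom (segreAway k e i j).toRingHom) :=
    (Iso.eq_inv_comp _).mpr h.isoPullback_hom_snd
  change IsClosedImmersion (pullback.snd (segre k e) (Proj.awayι _ (X (e (i, j)))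
    (X_mem_homogeneousSubmodule_one k (e (i, j))) Nat.one_pos))
  rw [hsnd]
  haveI : IsClosedImmersion (Spec.map (CommRingCat.ofHom (segreAway k e i j).toRingHom)) :=
    IsClosedImmersion.spec_of_surjective _ (segreAway_surjective k e i j)
  infer_instance

/-- the Segre morphism is a morphism over `Spec k` -/
theorem segre_structMap :
    segre k e ≫ structMap k υ = pullback.fst (structMap k σ) (structMap k τ) ≫ structMap k σ := by
  apply (prodChartCover k σ τ).hom_ext
  rintro ⟨i, j⟩
  have hL : (segreAway k e i j).toRingHom.comp (algebraMap k _) =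
      algebraMap k (Away (homogeneousSubmodule σ k) (X i) ⊗[k]
        Away (homogeneousSubmodule τ k) (X j)) :=
    (segreAway k e i j).comp_algebraMap
  have hR : (inclLeft k (X i) (X j)).comp (algebraMap k _) =
      algebraMap k (Away (homogeneousSubmodule σ k) (X i) ⊗[k]
        Away (homogeneousSubmodule τ k) (X j)) := by
    ext r
    rw [RingHom.comp_apply, inclLeft_apply, Algebra.TensorProduct.algebraMap_apply]
  show prodChart k (X_mem_homogeneousSubmodule_one k i) Nat.one_pos
      (X_mem_homogeneousSubmodule_one k j) Nat.one_pos ≫ segre k e ≫ structMap k υ =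
    prodChart k (X_mem_homogeneousSubmodule_one k i) Nat.one_pos
      (X_mem_homogeneousSubmodule_one k j) Nat.one_pos ≫
      pullback.fst (structMap k σ) (structMap k τ) ≫ structMap k σ
  rw [← Category.assoc, prodChart_segre, segreChartMap, Category.assoc,
    awayι_structMap, ← Category.assoc, prodChart_fst, Category.assoc, awayι_structMap,
    ← Spec.map_comp, ← Spec.map_comp, ← CommRingCat.ofHom_comp, ← CommRingCat.ofHom_comp, hL, hR]

end Summit.Ventures.HodgeRepro2.T6.A2Segre
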